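import Mathlib
import Literature.NumberTheory.Sieve.QuadraticRootsPrimeModuliDFISieveAsymptotics
import Summits.RiemannHypothesis.RiemannHypothesis.Theorems.DensityLadderSeparatedTowerTame
import HarnessLib

/-!
# `DensityLadder.SeparatedTowerDensityLine` (item stmt-RiemannHypothesis-24918) — tame-family sums
# with decaying weights, and the two families of K1 are tame

LINE L57 «sieve sight above the density line» (rh-idea-10 g1), crux K1 `SeparatedTowerDensityLine`
(stmt-RiemannHypothesis-24918), stub S1 `stub_separatedMeanValueCount` of the registered skeleton
`Birth.lean`, piece (T1) continued (companion of `DensityLadderSeparatedTowerTame`).  For a family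
`γ : J → ℝ`, `m ≥ 0` whose unit windows have mass `≤ C log(|t|+2)` and weights
`0 ≤ ω_j ≤ min(W₀, W₁/γ_j²)` (in the application `ω_j = ‖ĉ_j(η)‖`, `W₀ = 4 sup|φ|`,
`W₁ = (9/2) sup|φ''| · T²` from the two transform bounds of prover-l57):
* `tame_global_decay`: `Σ'_j m_j ω_j ≤ C (W₀ log 2 + 4 Z W₁)` with an absolute constant `Z`
  (`= Σ'_{n∈ℤ} |n|^{-3/2}`) — the decay-weighted GLOBAL mass is `O(T²)`;
* `tame_local_mass_decay`: `Σ'_j m_j ω_j e^{−c(γ_j−t)²} ≤ W₀ A C log(|t|+2)` and, for `t ≠ 0`,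
  `≤ (4W₁/t² · A + W₀ e^{−ct²/8} A') C log(|t|+2)` (near part `|γ_j − t| ≤ |t|/2`, far part);
* `onLine_window_hyp`: the on-line family of K1 (`Re ρ ≤ 1/2`, as a subtype) is tame with the
  constant of the hypothesis; `separated_window_mass`: a `g`-separated family with `0 ≤ m ≤ B` is tame
  with `C = B(2/g+1)/log 2`.
Constants are existential (no new definitions).  Cell rh-split, seat rh-split-prover-l57b g0.
STATUS: BANKED crux workfile (farm rc 0, sorry-free, NOT a Theorems landing): held under RULING #486
of cell rh-split («T1b HELD unless UPPER names it»); any prover of this crux may land it verbatim as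
`Theorems/DensityLadderSeparatedTowerTameDecay.lean --supports stmt-RiemannHypothesis-24918` if the
UPPER half / the tails of stub S1 want infinite-family decay-weighted sums.
RH-free, ζ-free; FRONTIER bookkeeping (DH-capped); nothing here bears on the truth of RH.
-/

set_option linter.dupNamespace false

noncomputable section

open Filter Set Topology

namespace Summit.RiemannHypothesis.RiemannHypothesis.Theorems.DensityLadderSeparatedTowerTameDecay

open Summit.RiemannHypothesis.RiemannHypothesis.Theorems.DensityLadderSeparatedTowerTame

variable {J : Type}

/-- The majorant of the decay-weighted global sum: for `n ≠ 0`,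
`log(2|n|+2)/(2|n|−1)² ≤ 4 |n|^{-3/2}`. [folklore] -/
theorem log_div_sq_le_rpow {n : ℤ} (hn : n ≠ 0) :
    Real.log (2 * |(n : ℝ)| + 2) / (2 * |(n : ℝ)| - 1) ^ 2 ≤ 4 * |(n : ℝ)| ^ (-(3 / 2 : ℝ)) := by
  have h1 : (1 : ℝ) ≤ |(n : ℝ)| := by
    rw [← Int.cast_abs]; exact_mod_cast Int.one_le_abs hn
  set a : ℝ := |(n : ℝ)| with ha
  have ha0 : 0 < a := by linarith
  have hlog : Real.log (2 * a + 2) ≤ 2 * Real.sqrt (2 * a + 2) :=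
    Literature.NumberTheory.Sieve.DFI1995.log_le_two_mul_sqrt (by linarith)
  have hsqrt : Real.sqrt (2 * a + 2) ≤ 2 * Real.sqrt a := by
    have h4 : Real.sqrt 4 = 2 := by
      rw [show (4 : ℝ) = 2 ^ 2 by norm_num]; exact Real.sqrt_sq (by norm_num)
    rw [show 2 * Real.sqrt a = Real.sqrt (4 * a) by
      rw [Real.sqrt_mul (by norm_num : (0 : ℝ) ≤ 4), h4]]
    exact Real.sqrt_le_sqrt (by linarith)
  have hden : a ^ 2 ≤ (2 * a - 1) ^ 2 := by nlinarith
  have hnum : Real.log (2 * a + 2) ≤ 4 * Real.sqrt a := by linarith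
  calc Real.log (2 * a + 2) / (2 * a - 1) ^ 2
      ≤ (4 * Real.sqrt a) / a ^ 2 := by
        refine div_le_div₀ (by positivity) hnum (by positivity) hden
    _ = 4 * |(n : ℝ)| ^ (-(3 / 2 : ℝ)) := by
        rw [← ha, Real.sqrt_eq_rpow, show (-(3 / 2 : ℝ)) = 1 / 2 - 2 by norm_num,
          Real.rpow_sub ha0, Real.rpow_two]
        ring

/-- **(T1.ii) Decay-weighted global mass of a tame family**: there is an absolute constant `Z ≥ 0`
such that for all weights `0 ≤ ω_j ≤ W₀` with `ω_j ≤ W₁/γ_j²` whenever `γ_j ≠ 0` (`W₀, W₁ ≥ 0`),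
`Σ'_j m_j ω_j ≤ C (W₀ log 2 + 4 Z W₁)` and the family is summable. [folklore] -/
theorem tame_global_decay (m : J → ℝ) (γ : J → ℝ) (hm : ∀ j, 0 ≤ m j) {C : ℝ}
    (hwin : ∀ t : ℝ, {j | |γ j - t| ≤ 1}.Finite ∧
      ∑ᶠ j ∈ {j | |γ j - t| ≤ 1}, m j ≤ C * Real.log (|t| + 2)) :
    ∃ Z : ℝ, 0 ≤ Z ∧ ∀ (ω : J → ℝ) (W₀ W₁ : ℝ), (∀ j, 0 ≤ ω j) → 0 ≤ W₀ → 0 ≤ W₁ →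
      (∀ j, ω j ≤ W₀) → (∀ j, γ j ≠ 0 → ω j ≤ W₁ / (γ j) ^ 2) →
      Summable (fun j ↦ m j * ω j) ∧
      ∑' j, m j * ω j ≤ C * (W₀ * Real.log 2 + 4 * Z * W₁) := by
  classical
  have hC := windowConst_nonneg m γ hm hwin
  refine ⟨∑' n : ℤ, |(n : ℝ)| ^ (-(3 / 2 : ℝ)), tsum_nonneg fun _ ↦ Real.rpow_nonneg (abs_nonneg _) _,
    fun ω W₀ W₁ hω0 hW0 hW1 hωW0 hωW1 ↦ ?_⟩
  set Z : ℝ := ∑' n : ℤ, |(n : ℝ)| ^ (-(3 / 2 : ℝ)) with hZ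
  -- window majorant at `t = 0`
  set F : ℤ → ℝ := fun n ↦ if n = 0 then W₀ else W₁ / (2 * |(n : ℝ)| - 1) ^ 2 with hF
  have hF0 : ∀ n, 0 ≤ F n := by
    intro n
    by_cases h : n = 0
    · simp only [hF, h, if_true]; exact hW0
    · simp only [hF, h, if_false]; positivity
  -- summable majorant of `F n * log(|2n|+2)`
  set G : ℤ → ℝ := fun n ↦ W₀ * Real.log 2 * (if n = 0 then (1 : ℝ) else 0) +
    4 * W₁ * |(n : ℝ)| ^ (-(3 / 2 : ℝ)) with hG
  have hFG : ∀ n : ℤ, F n * Real.log (|(0 : ℝ) + 2 * (n : ℝ)| + 2) ≤ G n := by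
    intro n
    rw [zero_add, abs_mul, abs_two]
    by_cases h : n = 0
    · simp only [hF, hG, h, if_true, Int.cast_zero, abs_zero, mul_zero, zero_add, mul_one]
      rw [Real.zero_rpow (by norm_num), mul_zero, add_zero]
    · simp only [hF, hG, h, if_false, mul_zero, zero_add]
      have key := log_div_sq_le_rpow h
      calc W₁ / (2 * |(n : ℝ)| - 1) ^ 2 * Real.log (2 * |(n : ℝ)| + 2)
          = W₁ * (Real.log (2 * |(n : ℝ)| + 2) / (2 * |(n : ℝ)| - 1) ^ 2) := by ring
        _ ≤ W₁ * (4 * |(n : ℝ)| ^ (-(3 / 2 : ℝ))) := mul_le_mul_of_nonneg_left key hW1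
        _ = 4 * W₁ * |(n : ℝ)| ^ (-(3 / 2 : ℝ)) := by ring
  have hG1 : Summable fun n : ℤ ↦ (if n = 0 then (1 : ℝ) else 0) := by
    refine summable_of_ne_finset_zero (s := {0}) fun n hn ↦ ?_
    rw [Finset.mem_singleton] at hn
    simp [hn]
  have hG2 : Summable fun n : ℤ ↦ |(n : ℝ)| ^ (-(3 / 2 : ℝ)) :=
    Real.summable_abs_int_rpow (by norm_num)
  have hGs : Summable G := (hG1.mul_left (W₀ * Real.log 2)).add (hG2.mul_left (4 * W₁))
  have hGsum : ∑' n, G n = W₀ * Real.log 2 + 4 * Z * W₁ := by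
    simp only [hG]
    rw [(hG1.mul_left (W₀ * Real.log 2)).tsum_add (hG2.mul_left (4 * W₁)), tsum_mul_left,
      tsum_mul_left, tsum_ite_eq]
    rw [hZ]; ring
  have hnn : ∀ n : ℤ, 0 ≤ F n * Real.log (|(0 : ℝ) + 2 * (n : ℝ)| + 2) := fun n ↦
    mul_nonneg (hF0 n) (Real.log_nonneg (by linarith [abs_nonneg ((0 : ℝ) + 2 * (n : ℝ))]))
  have hFs : Summable fun n : ℤ ↦ F n * Real.log (|(0 : ℝ) + 2 * (n : ℝ)| + 2) :=
    Summable.of_nonneg_of_le hnn hFG hGs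
  -- termwise: `ω_j ≤ F(n_j)`
  have hterm : ∀ j, ω j ≤ F (round ((γ j - 0) / 2)) := by
    intro j
    set n : ℤ := round ((γ j - 0) / 2) with hn
    by_cases h : n = 0
    · simp only [hF, h, if_true]; exact hωW0 j
    · simp only [hF, h, if_false]
      have h1 : (1 : ℝ) ≤ |(n : ℝ)| := by
        rw [← Int.cast_abs]; exact_mod_cast Int.one_le_abs h
      have hw := abs_sub_window_le 0 (γ j)
      rw [← hn, zero_add] at hw
      have hγ : 2 * |(n : ℝ)| - 1 ≤ |γ j| := by
        have := abs_sub_abs_le_abs_sub (2 * (n : ℝ)) (γ j)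
        rw [abs_sub_comm, abs_mul, abs_two] at this
        linarith
      have hγ0 : γ j ≠ 0 := by
        rw [← abs_pos]; linarith
      have hsq : (2 * |(n : ℝ)| - 1) ^ 2 ≤ (γ j) ^ 2 := by
        rw [← sq_abs (γ j)]
        exact pow_le_pow_left₀ (by linarith) hγ 2
      exact (hωW1 j hγ0).trans (div_le_div_of_nonneg_left hW1 (pow_pos (by linarith) 2) hsq)
  have hbound : ∀ u : Finset J, ∑ j ∈ u, m j * ω j ≤ C * (W₀ * Real.log 2 + 4 * Z * W₁) := by
    intro u
    calc ∑ j ∈ u, m j * ω j ≤ ∑ j ∈ u, m j * F (round ((γ j - 0) / 2)) :=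
          Finset.sum_le_sum fun j _ ↦ mul_le_mul_of_nonneg_left (hterm j) (hm j)
      _ ≤ C * ∑' n : ℤ, F n * Real.log (|(0 : ℝ) + 2 * (n : ℝ)| + 2) :=
          sum_window_le m γ hm hwin 0 hF0 hFs u
      _ ≤ C * ∑' n : ℤ, G n := mul_le_mul_of_nonneg_left (hFs.tsum_le_tsum hFG hGs) hC
      _ = _ := by rw [hGsum]
  have hnn' : ∀ j, 0 ≤ m j * ω j := fun j ↦ mul_nonneg (hm j) (hω0 j)
  exact ⟨summable_of_sum_le hnn' hbound, Real.tsum_le_of_sum_le hnn' hbound⟩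

/-- **(T1.iii) Decay-weighted Gaussian local mass of a tame family**: for `c > 0` there are
constants `A, A' ≥ 0` (the Gaussian local-mass constants at `c` and `c/2`) such that for all weights
as in `tame_global_decay` and every `t`, `M(t) = Σ'_j m_j ω_j e^{−c(γ_j−t)²}` is summable,
`M(t) ≤ W₀ A C log(|t|+2)`, and for `t ≠ 0`
`M(t) ≤ (4W₁/t² · A + W₀ e^{−ct²/8} A') · C · log(|t|+2)`
(near part `|γ_j − t| ≤ |t|/2` has `|γ_j| ≥ |t|/2`, far part carries `e^{−ct²/8}`). [folklore] -/
theorem tame_local_mass_decay (m : J → ℝ) (γ : J → ℝ) (hm : ∀ j, 0 ≤ m j) {C : ℝ}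
    (hwin : ∀ t : ℝ, {j | |γ j - t| ≤ 1}.Finite ∧
      ∑ᶠ j ∈ {j | |γ j - t| ≤ 1}, m j ≤ C * Real.log (|t| + 2))
    {c : ℝ} (hc : 0 < c) :
    ∃ A A' : ℝ, 0 ≤ A ∧ 0 ≤ A' ∧ ∀ (ω : J → ℝ) (W₀ W₁ : ℝ), (∀ j, 0 ≤ ω j) → 0 ≤ W₀ → 0 ≤ W₁ →
      (∀ j, ω j ≤ W₀) → (∀ j, γ j ≠ 0 → ω j ≤ W₁ / (γ j) ^ 2) → ∀ t : ℝ,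
      Summable (fun j ↦ m j * ω j * Real.exp (-(c * (γ j - t) ^ 2))) ∧
      ∑' j, m j * ω j * Real.exp (-(c * (γ j - t) ^ 2)) ≤ W₀ * A * C * Real.log (|t| + 2) ∧
      (t ≠ 0 → ∑' j, m j * ω j * Real.exp (-(c * (γ j - t) ^ 2)) ≤
        (4 * W₁ / t ^ 2 * A + W₀ * Real.exp (-(c * t ^ 2 / 8)) * A') * C * Real.log (|t| + 2)) := by
  have hC := windowConst_nonneg m γ hm hwin
  obtain ⟨A, hA0, hA⟩ := tame_local_mass m γ hm hwin hc
  obtain ⟨A', hA0', hA'⟩ := tame_local_mass m γ hm hwin (half_pos hc)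
  refine ⟨A, A', hA0, hA0', fun ω W₀ W₁ hω0 hW0 hW1 hωW0 hωW1 t ↦ ?_⟩
  obtain ⟨hs1, hb1⟩ := hA t
  obtain ⟨hs2, hb2⟩ := hA' t
  have hnn : ∀ j, 0 ≤ m j * ω j * Real.exp (-(c * (γ j - t) ^ 2)) := fun j ↦
    mul_nonneg (mul_nonneg (hm j) (hω0 j)) (Real.exp_pos _).le
  -- crude termwise bound
  have hcrude : ∀ j, m j * ω j * Real.exp (-(c * (γ j - t) ^ 2)) ≤
      W₀ * (m j * Real.exp (-(c * (γ j - t) ^ 2))) := by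
    intro j
    calc m j * ω j * Real.exp (-(c * (γ j - t) ^ 2))
        = ω j * (m j * Real.exp (-(c * (γ j - t) ^ 2))) := by ring
      _ ≤ W₀ * (m j * Real.exp (-(c * (γ j - t) ^ 2))) :=
          mul_le_mul_of_nonneg_right (hωW0 j) (mul_nonneg (hm j) (Real.exp_pos _).le)
  have hsum : Summable (fun j ↦ m j * ω j * Real.exp (-(c * (γ j - t) ^ 2))) :=
    Summable.of_nonneg_of_le hnn hcrude (hs1.mul_left W₀)
  refine ⟨hsum, ?_, fun ht ↦ ?_⟩
  · calc ∑' j, m j * ω j * Real.exp (-(c * (γ j - t) ^ 2))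
        ≤ ∑' j, W₀ * (m j * Real.exp (-(c * (γ j - t) ^ 2))) :=
          hsum.tsum_le_tsum hcrude (hs1.mul_left W₀)
      _ = W₀ * ∑' j, m j * Real.exp (-(c * (γ j - t) ^ 2)) := tsum_mul_left
      _ ≤ W₀ * (A * C * Real.log (|t| + 2)) := mul_le_mul_of_nonneg_left hb1 hW0
      _ = _ := by ring
  · have ht2 : 0 < t ^ 2 := by positivity
    -- refined termwise bound: near part + far part
    have hfine : ∀ j, m j * ω j * Real.exp (-(c * (γ j - t) ^ 2)) ≤
        4 * W₁ / t ^ 2 * (m j * Real.exp (-(c * (γ j - t) ^ 2))) +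
          W₀ * Real.exp (-(c * t ^ 2 / 8)) * (m j * Real.exp (-(c / 2 * (γ j - t) ^ 2))) := by
      intro j
      have hmj := hm j
      have hA : 0 ≤ 4 * W₁ / t ^ 2 * (m j * Real.exp (-(c * (γ j - t) ^ 2))) := by positivity
      have hB : 0 ≤ W₀ * Real.exp (-(c * t ^ 2 / 8)) *
          (m j * Real.exp (-(c / 2 * (γ j - t) ^ 2))) := by positivity
      by_cases hnear : |γ j - t| ≤ |t| / 2
      · -- near: `|γ_j| ≥ |t|/2 > 0`, so `ω_j ≤ 4 W₁ / t²`
        have hγ : |t| / 2 ≤ |γ j| := by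
          have := abs_sub_abs_le_abs_sub t (γ j)
          rw [abs_sub_comm] at this
          linarith
        have hγ0 : γ j ≠ 0 := by
          rw [← abs_pos]
          have : 0 < |t| := abs_pos.2 ht
          linarith
        have hsq : t ^ 2 / 4 ≤ (γ j) ^ 2 := by
          rw [← sq_abs (γ j), ← sq_abs t]
          nlinarith [abs_nonneg t, abs_nonneg (γ j)]
        have hω : ω j ≤ 4 * W₁ / t ^ 2 :=
          calc ω j ≤ W₁ / (γ j) ^ 2 := hωW1 j hγ0
            _ ≤ W₁ / (t ^ 2 / 4) := div_le_div_of_nonneg_left hW1 (by positivity) hsq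
            _ = 4 * W₁ / t ^ 2 := by field_simp
        calc m j * ω j * Real.exp (-(c * (γ j - t) ^ 2))
            = ω j * (m j * Real.exp (-(c * (γ j - t) ^ 2))) := by ring
          _ ≤ 4 * W₁ / t ^ 2 * (m j * Real.exp (-(c * (γ j - t) ^ 2))) :=
              mul_le_mul_of_nonneg_right hω (mul_nonneg (hm j) (Real.exp_pos _).le)
          _ ≤ _ := le_add_of_nonneg_right hB
      · -- far: `(γ_j − t)² ≥ t²/4`, so `e^{-c(γ-t)²} ≤ e^{-ct²/8} e^{-(c/2)(γ-t)²}`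
        rw [not_le] at hnear
        have hsq : t ^ 2 / 4 ≤ (γ j - t) ^ 2 := by
          rw [← sq_abs (γ j - t), ← sq_abs t]
          nlinarith [abs_nonneg t, abs_nonneg (γ j - t)]
        have hexp : Real.exp (-(c * (γ j - t) ^ 2)) ≤
            Real.exp (-(c * t ^ 2 / 8)) * Real.exp (-(c / 2 * (γ j - t) ^ 2)) := by
          rw [← Real.exp_add, Real.exp_le_exp]
          nlinarith [hc.le]
        calc m j * ω j * Real.exp (-(c * (γ j - t) ^ 2))
            ≤ m j * W₀ * (Real.exp (-(c * t ^ 2 / 8)) * Real.exp (-(c / 2 * (γ j - t) ^ 2))) :=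
              mul_le_mul (mul_le_mul_of_nonneg_left (hωW0 j) (hm j)) hexp (Real.exp_pos _).le
                (mul_nonneg (hm j) hW0)
          _ = W₀ * Real.exp (-(c * t ^ 2 / 8)) * (m j * Real.exp (-(c / 2 * (γ j - t) ^ 2))) := by
              ring
          _ ≤ _ := le_add_of_nonneg_left hA
    have hsA : Summable fun j ↦ 4 * W₁ / t ^ 2 * (m j * Real.exp (-(c * (γ j - t) ^ 2))) :=
      hs1.mul_left _
    have hsB : Summable fun j ↦
        W₀ * Real.exp (-(c * t ^ 2 / 8)) * (m j * Real.exp (-(c / 2 * (γ j - t) ^ 2))) :=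
      hs2.mul_left _
    calc ∑' j, m j * ω j * Real.exp (-(c * (γ j - t) ^ 2))
        ≤ ∑' j, (4 * W₁ / t ^ 2 * (m j * Real.exp (-(c * (γ j - t) ^ 2))) +
            W₀ * Real.exp (-(c * t ^ 2 / 8)) * (m j * Real.exp (-(c / 2 * (γ j - t) ^ 2)))) :=
          hsum.tsum_le_tsum hfine (hsA.add hsB)
      _ = 4 * W₁ / t ^ 2 * ∑' j, m j * Real.exp (-(c * (γ j - t) ^ 2)) +
            W₀ * Real.exp (-(c * t ^ 2 / 8)) * ∑' j, m j * Real.exp (-(c / 2 * (γ j - t) ^ 2)) := by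
          rw [hsA.tsum_add hsB, tsum_mul_left, tsum_mul_left]
      _ ≤ 4 * W₁ / t ^ 2 * (A * C * Real.log (|t| + 2)) +
            W₀ * Real.exp (-(c * t ^ 2 / 8)) * (A' * C * Real.log (|t| + 2)) :=
          add_le_add (mul_le_mul_of_nonneg_left hb1 (by positivity))
            (mul_le_mul_of_nonneg_left hb2 (by positivity))
      _ = _ := by ring

/-! ## The two families of K1 are tame -/

/-- **The on-line family is tame.**  The unit-window hypothesis of K1 on `{i | Re ρ_i ≤ 1/2}`,
transported to the subtype `{i // Re ρ_i ≤ 1/2}` (same constant). [folklore] -/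
theorem onLine_window_hyp {ι : Type} (m : ι → ℝ) (ρ : ι → ℂ) {C : ℝ}
    (h : ∀ T : ℝ, {i : ι | (ρ i).re ≤ 1 / 2 ∧ |(ρ i).im - T| ≤ 1}.Finite ∧
      (∑ᶠ i ∈ {i : ι | (ρ i).re ≤ 1 / 2 ∧ |(ρ i).im - T| ≤ 1}, m i) ≤ C * Real.log (|T| + 2))
    (t : ℝ) :
    {j : {i : ι // (ρ i).re ≤ 1 / 2} | |(ρ j.1).im - t| ≤ 1}.Finite ∧
    ∑ᶠ j ∈ {j : {i : ι // (ρ i).re ≤ 1 / 2} | |(ρ j.1).im - t| ≤ 1}, m j.1 ≤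
      C * Real.log (|t| + 2) := by
  obtain ⟨hfin, hsum⟩ := h t
  have hbij : Set.BijOn (Subtype.val : {i : ι // (ρ i).re ≤ 1 / 2} → ι)
      {j | |(ρ j.1).im - t| ≤ 1} {i | (ρ i).re ≤ 1 / 2 ∧ |(ρ i).im - t| ≤ 1} :=
    ⟨fun j hj ↦ ⟨j.2, hj⟩, Subtype.val_injective.injOn, fun i hi ↦ ⟨⟨i, hi.1⟩, hi.2, rfl⟩⟩
  refine ⟨?_, ?_⟩
  · exact Set.Finite.of_finite_image (hbij.image_eq.symm ▸ hfin) hbij.injOn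
  · rw [finsum_mem_eq_of_bijOn Subtype.val hbij (fun j _ ↦ rfl)]
    exact hsum

/-- **A separated family is tame.**  If the `γ_j` are `g`-separated (`g > 0`) and `0 ≤ m_j ≤ B`
(`B ≥ 0`), every unit window `{|γ_j − t| ≤ 1}` is finite with at most `2/g + 1` members, so its
mass is `≤ B(2/g+1) ≤ (B(2/g+1)/log 2) · log(|t|+2)`. [folklore] -/
theorem separated_window_mass (m : J → ℝ) (γ : J → ℝ) {B : ℝ} (hB : 0 ≤ B)
    (hmB : ∀ j, m j ≤ B) {g : ℝ} (hg : 0 < g) (hsep : ∀ j j' : J, j ≠ j' → g ≤ |γ j - γ j'|)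
    (t : ℝ) :
    {j | |γ j - t| ≤ 1}.Finite ∧
    ∑ᶠ j ∈ {j | |γ j - t| ≤ 1}, m j ≤ B * (2 / g + 1) / Real.log 2 * Real.log (|t| + 2) := by
  classical
  set S : Set J := {j | |γ j - t| ≤ 1} with hS
  set k : J → ℕ := fun j ↦ ⌊(γ j - t + 1) / g⌋₊ with hk
  have hinj : Set.InjOn k S := by
    intro j hj j' hj' hjj'
    by_contra hne
    have hs := hsep j j' hne
    simp only [hS, Set.mem_setOf_eq, abs_le] at hj hj'
    have ha : 0 ≤ (γ j - t + 1) / g := div_nonneg (by linarith) hg.le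
    have ha' : 0 ≤ (γ j' - t + 1) / g := div_nonneg (by linarith) hg.le
    have h1 := Nat.floor_le ha
    have h2 := Nat.lt_floor_add_one ((γ j - t + 1) / g)
    have h1' := Nat.floor_le ha'
    have h2' := Nat.lt_floor_add_one ((γ j' - t + 1) / g)
    have hkk : (⌊(γ j - t + 1) / g⌋₊ : ℝ) = ⌊(γ j' - t + 1) / g⌋₊ := by
      have : k j = k j' := hjj'
      simp only [hk] at this
      exact_mod_cast this
    rw [hkk] at h1 h2
    have hlt : |(γ j - t + 1) / g - (γ j' - t + 1) / g| < 1 := by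
      rw [abs_lt]; constructor <;> linarith
    rw [← sub_div, abs_div, abs_of_pos hg, div_lt_one hg] at hlt
    have e : γ j - t + 1 - (γ j' - t + 1) = γ j - γ j' := by ring
    rw [e] at hlt
    linarith
  have himg : k '' S ⊆ (Finset.range (⌊2 / g⌋₊ + 1) : Set ℕ) := by
    intro n hn
    obtain ⟨j, hj, rfl⟩ := hn
    simp only [hS, Set.mem_setOf_eq, abs_le] at hj
    rw [Finset.coe_range, Set.mem_Iio, Nat.lt_add_one_iff]
    exact Nat.floor_le_floor (div_le_div_of_nonneg_right (by linarith) hg.le)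
  have hfinImg : (k '' S).Finite := (Finset.finite_toSet _).subset himg
  have hfin : S.Finite := Set.Finite.of_finite_image hfinImg hinj
  refine ⟨hfin, ?_⟩
  have hcard : (hfin.toFinset.card : ℝ) ≤ 2 / g + 1 := by
    have hinj' : Set.InjOn k (hfin.toFinset : Set J) := by
      rw [Set.Finite.coe_toFinset]; exact hinj
    have h1 : hfin.toFinset.card = (hfin.toFinset.image k).card :=
      (Finset.card_image_of_injOn hinj').symm
    have h2 : hfin.toFinset.image k ⊆ Finset.range (⌊2 / g⌋₊ + 1) := by
      intro n hn
      rw [Finset.mem_image] at hn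
      obtain ⟨j, hj, rfl⟩ := hn
      have : k j ∈ k '' S := ⟨j, by simpa using hj, rfl⟩
      exact_mod_cast himg this
    have h3 := Finset.card_le_card h2
    rw [Finset.card_range] at h3
    rw [h1]
    calc ((hfin.toFinset.image k).card : ℝ) ≤ ((⌊2 / g⌋₊ + 1 : ℕ) : ℝ) := by exact_mod_cast h3
      _ = (⌊2 / g⌋₊ : ℝ) + 1 := by push_cast; ring
      _ ≤ 2 / g + 1 := by linarith [Nat.floor_le (show 0 ≤ 2 / g by positivity)]
  rw [finsum_mem_eq_finite_toFinset_sum _ hfin]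
  have hlog2 : 0 < Real.log 2 := Real.log_pos (by norm_num)
  have hlog : Real.log 2 ≤ Real.log (|t| + 2) :=
    Real.log_le_log (by norm_num) (by linarith [abs_nonneg t])
  have hratio : 1 ≤ Real.log (|t| + 2) / Real.log 2 := by
    rw [le_div_iff₀ hlog2, one_mul]; exact hlog
  calc ∑ j ∈ hfin.toFinset, m j ≤ ∑ j ∈ hfin.toFinset, B := Finset.sum_le_sum fun j _ ↦ hmB j
    _ = hfin.toFinset.card * B := by rw [Finset.sum_const, nsmul_eq_mul]
    _ ≤ (2 / g + 1) * B := mul_le_mul_of_nonneg_right hcard hB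
    _ = B * (2 / g + 1) * 1 := by ring
    _ ≤ B * (2 / g + 1) * (Real.log (|t| + 2) / Real.log 2) :=
        mul_le_mul_of_nonneg_left hratio (by positivity)
    _ = B * (2 / g + 1) / Real.log 2 * Real.log (|t| + 2) := by ring

end Summit.RiemannHypothesis.RiemannHypothesis.Theorems.DensityLadderSeparatedTowerTameDecay

end
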